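import Literature.Topology.FourManifolds.GenusThreePrimitiveOrReducing
import Literature.Topology.FourManifolds.CircleSurgery
import HarnessLib

/-!
# Five-chain surgery: a genus-three trisection containing a five-chain is a loop surgery on a genus-two trisected 4-manifold (Aranda–Zupan 2025, Lemma 5.4 + Prop. 5.5)

Topic `Literature/Topology/FourManifolds`, after `GenusThreePrimitiveOrReducing.lean` (the
predicate `Trisection.MeetsOnceTransv`, "`|c ∩ c′| = 1`" for concrete curves) and
`CircleSurgery.lean` (`IsCircleSurgery`).  ONE NAMED FACT, no definition, nothing proved:

* `Literature.Topology.FourManifolds.arandaZupan_fiveChain_loopSurgery_gk` — Aranda–Zupan,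
  *Manifolds with weakly reducible genus-three trisections are standard* (arXiv:2503.04607, 2025),
  §5: the definition of a FIVE-CHAIN (p. 18), **Lemma 5.4** (p. 19) and **Proposition 5.5**
  (pp. 19–20), verbatim:
  - (p. 18) "We say that the trisection diagram contains a *five-chain* `{γ₂, β₁, α₁, γ₁, β₂}` if
    `α₁ ∩ β₂ = α₁ ∩ γ₂ = β₂ ∩ γ₂ = β₁ ∩ γ₁ = ∅` and
    `|γ₂ ∩ β₁| = |β₁ ∩ α₁| = |α₁ ∩ γ₁| = |γ₁ ∩ β₂| = 1`, and if one component `P` of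
    `Σ ∖ (α₁ ∪ β₂ ∪ γ₂)` is a pair of pants (a thrice-punctured sphere)."
  - (Lemma 5.4) "If `(Σ; α, β, γ)` is a `(g; k₁, k₂, k₃)`-trisection diagram containing a
    five-chain, and `(Σ_{α₁}; α′, β′, γ′)` is obtained by five-chain surgery, then
    `(Σ_{α₁}; α′, β′, γ′)` is a `(g − 1; k₁, k₂, k₃ + 1)`-trisection diagram."
  - (Prop. 5.5) "Suppose a trisection diagram for a 4-manifold `X` contains a five-chain.  Then
    the trisection diagram obtained by surgery on a five-chain corresponds to a 4-manifold `X′`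
    obtained by surgery on a 2-sphere in `X`.  Conversely, `X` is obtained by surgery on a loop
    in `X′`."
  together with the standard fact the paper uses throughout (§2, p. 5): "a trisection is
  determined up to diffeomorphism by a trisection diagram `(Σ; α, β, γ)`, in which `α`, `β`, and
  `γ` are cut systems for `H₁`, `H₂`, and `H₃`" [GK16].  Combined, and read as a statement about
  the 4-manifold: *if a genus-three trisection of `X` admits a diagram containing a five-chain,
  then `X` is obtained by surgery on a loop in a 4-manifold `X′` admitting a genus-two
  trisection.*

## How it is rendered (relative to the tree's notions, D-0014)

Over `IsGKTrisection` and the concrete-curve vocabulary of `WeaklyReducibleTrisections.lean`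
(`IsCurve`, `BoundsDisc`, `IsNonSeparating`, `spineHandlebody`, `centralSurfaceSet`) and
`Trisection.MeetsOnceTransv`, for the case the paper is about: GENUS THREE with all `kᵢ ≤ 1`
(Prop. 2.6 and p. 6: "we will henceforth assume that any `(3; k₁, k₂, k₃)`-trisection appearing
in this paper will satisfy `kᵢ ∈ {0, 1}`"), `X` orientable (§2, p. 3).  The five-chain is given by
five CONCRETE curves on the central surface `F`, indexed by a CENTRE label `p` and the two other
labels `j ≠ l` (print: centre `α₁`, neighbours `β₁`, `γ₁`, ends `γ₂`, `β₂`; any relabelling of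
the sectors is allowed since `IsGKTrisection` is symmetric): a centre `c` compressing in `H_p`,
NEIGHBOURS `n_j ⊂ H_j`-compressing and `n_l ⊂ H_l`-compressing, ENDS `e_j ⊂ H_j`-compressing and
`e_l ⊂ H_l`-compressing, with the printed intersection pattern — `c ∩ e_j = c ∩ e_l = e_j ∩ e_l =
n_j ∩ n_l = ∅`, `|e_l ∩ n_j| = |n_j ∩ c| = |c ∩ n_l| = |n_l ∩ e_j| = 1` (`MeetsOnceTransv`) —
plus the disjointness of same-colour curves (`n_j ∩ e_j = n_l ∩ e_l = ∅`, implicit in print since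
`{β₁, β₂} ⊂ β` and `{γ₁, γ₂} ⊂ γ` are cut systems) and the pants clause rendered by separation
properties: `c`, `e_j`, `e_l` are non-separating, pairwise mutually non-separating, and
`F ∖ (c ∪ e_j ∪ e_l)` is disconnected — on the closed genus-`3` surface this says exactly that the
three curves cut `F` into a pair of pants and a thrice-punctured torus (Euler characteristic: two
components, each adjacent to all three curves, genera `g₁ + g₂ = 1`; cf. §7 p. 24, configuration
(3)), so "one component of `Σ ∖ (α₁ ∪ β₂ ∪ γ₂)` is a pair of pants" holds.  Why these concrete data
give a DIAGRAM containing a five-chain in the printed sense: one transverse intersection point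
realises geometric intersection number one and concrete disjointness realises zero; a curve with
a transverse dual is non-separating, and `{n_j, e_j}` is jointly non-separating (the closed curve
`c` crosses the multicurve `n_j ∪ e_j` exactly once, impossible if it separated), so `{n_j, e_j}`
extends to a cut system of the genus-`3` handlebody `H_j` (compress along the two discs), likewise
`{n_l, e_l}` for `H_l` and `{c}` for `H_p`, and any three cut systems of `H_α, H_β, H_γ` form a
trisection diagram of `𝒯` (pairs are Heegaard diagrams of `∂X_i = #^{k_i}(S¹ × S²)`).
Conclusion, weakened to what consumers need: SOME smooth `X′` (Hausdorff, second countable,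
charted on `ℝ⁴`, same universe) with SOME genus-`2` GK-trisection (`∃ k′ T′`, the printed type
`(2; k_j, k_l, k_p + 1)` up to the relabelling is not asserted) and a loop `ℓ` with
`IsCircleSurgery (𝓡 4) (𝓡 4) X′ X ℓ` ("`X` is obtained by surgery on a loop in `X′`").

This is the five-chain surgery step shared by the two genus-three theorems of the paper: the
five-chain case of Thm. 1.3 (§6; tracked inline as `h5`/`hirr` in
`Literature/Barriers/SmoothPoincare4/WeaklyReducibleGenusThreeStandard*.lean`) and the pants case
of Thm. 1.4 (§7 pp. 25–26, the five-chain `{γ₁, β₂, α₁, γ₂*, β₁}` of Fig. 19; crux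
stmt-SmoothPoincare4-18000 of route `WeakReductionDescent`).  Printed proof: Lemma 5.3 (slides
making the other diagram curves meet `P` in seams), Lemma 5.4 (the surgered diagram pairs to
`#^{k}(S¹ × S²)`'s: two destabilisations and a genus-two `S³`-summand computation), Prop. 5.5 via
Thm. 5.1 (= [AM22, Thm. 7.1], ⋆-trisections and surgery on a decomposed curve), slides and a
destabilisation (Fig. 15).  None of the diagrammatic calculus (cut systems, handle slides,
realisation/uniqueness of the trisected 4-manifold of a diagram, ⋆-trisections) is in the tree;
users take `(h : arandaZupan_fiveChain_loopSurgery_gk)`.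

## References

* R. Aranda, A. Zupan, *Manifolds with weakly reducible genus-three trisections are standard*,
  arXiv:2503.04607 (2025): §5 (pp. 16–20: Thm. 5.1, five-chains p. 18, Lemma 5.3, Lemma 5.4,
  Prop. 5.5, Figs. 9, 12–15); §2 (pp. 5–6); §7 (pp. 25–26).  Held: `paper:arxiv-2503.04607`.
  [ArandaZupan2025]
* D. Gay, R. Kirby, *Trisecting 4-manifolds*, Geom. Topol. 20 (2016), §2 (trisection diagrams
  determine the trisection). [GayKirby2016]
* R. Aranda, J. Moeller, *Diagrams of ⋆-trisections*, Math. Res. Lett. 29 (2022) [AM22], Thm. 7.1.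
-/

noncomputable section

open scoped Manifold ContDiff Topology
open Set

namespace Literature.Topology.FourManifolds

universe u

/-- **Aranda–Zupan 2025, five-chain surgery (Lemma 5.4 + Prop. 5.5; named fact, concrete-curve
form at genus three): a genus-three trisection whose central surface carries a five-chain
presents the 4-manifold as a loop surgery on a genus-two trisected 4-manifold.**  Printed
(arXiv:2503.04607): five-chain `{γ₂, β₁, α₁, γ₁, β₂}` (p. 18) — "`α₁ ∩ β₂ = α₁ ∩ γ₂ = β₂ ∩ γ₂ =
β₁ ∩ γ₁ = ∅` and `|γ₂ ∩ β₁| = |β₁ ∩ α₁| = |α₁ ∩ γ₁| = |γ₁ ∩ β₂| = 1`, and … one component `P` of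
`Σ ∖ (α₁ ∪ β₂ ∪ γ₂)` is a pair of pants"; Lemma 5.4 (p. 19) — five-chain surgery on a
`(g; k₁, k₂, k₃)`-trisection diagram gives a `(g − 1; k₁, k₂, k₃ + 1)`-trisection diagram;
Prop. 5.5 (pp. 19–20) — "… corresponds to a 4-manifold `X′` obtained by surgery on a 2-sphere in
`X`.  Conversely, `X` is obtained by surgery on a loop in `X′`"; and (§2, p. 5) "a trisection is
determined up to diffeomorphism by a trisection diagram".  Here: `X` an orientable smooth
`4`-manifold with a `(3; k)`-trisection `T`, all `k m ≤ 1`; labels `p` (centre), `j`, `l`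
pairwise distinct; concrete curves on the central surface `F`: centre `c ⊂ H_p`-compressing,
neighbours `nj ⊂ H_j`-, `nl ⊂ H_l`-compressing, ends `ej ⊂ H_j`-, `el ⊂ H_l`-compressing
(`H_m = Trisection.spineHandlebody T m`), with `c`, `ej`, `el` pairwise disjoint, non-separating,
pairwise mutually non-separating and jointly separating (the pants `P` and a thrice-punctured
torus), `nj ∩ nl = nj ∩ ej = nl ∩ el = ∅`, and `nj` meeting `c` and `el` once transversally, `nl`
meeting `c` and `ej` once transversally (`Trisection.MeetsOnceTransv`).  Conclusion: `X` is a
circle surgery on a loop `ℓ` of some smooth `X′` carrying a genus-`2` GK-trisection.  See the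
module docstring for the translation (cut systems from the concrete curves, the pants clause by
Euler characteristic) and for what is weakened (the type `(2; k_j, k_l, k_p + 1)` of `X′`'s
trisection is not asserted).  Users take `(h : arandaZupan_fiveChain_loopSurgery_gk)`.
-- TODO(general form): any genus `g` and type `(g; k₁, k₂, k₃)`, with the surgered type
-- `(g − 1; k₁, k₂, k₃ + 1)`, once trisection DIAGRAMS (cut systems, slides) are in the tree.
[cite: ArandaZupan2025, §5: five-chains (p. 18), Lemma 5.4 (p. 19), Prop. 5.5 (pp. 19–20); §2 (p. 5)] -/
def arandaZupan_fiveChain_loopSurgery_gk : Prop :=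
  ∀ (X : Type u) [TopologicalSpace X] [T2Space X] [SecondCountableTopology X]
    [ChartedSpace (EuclideanSpace ℝ (Fin 4)) X] [IsManifold (𝓡 4) ∞ X],
    IsOrientable (𝓡 4) X → ∀ (k : Fin 3 → ℕ) (T : Fin 3 → Set X), IsGKTrisection X 3 k T →
    (∀ m, k m ≤ 1) → ∀ p j l : Fin 3, p ≠ j → p ≠ l → j ≠ l →
    ∀ c ej el nj nl : Set X,
      -- the five curves and their compressing sides
      Trisection.IsCurve T c → Trisection.IsCurve T ej → Trisection.IsCurve T el →
      Trisection.IsCurve T nj → Trisection.IsCurve T nl →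
      Trisection.BoundsDisc T (Trisection.spineHandlebody T p) c →
      Trisection.BoundsDisc T (Trisection.spineHandlebody T j) ej →
      Trisection.BoundsDisc T (Trisection.spineHandlebody T l) el →
      Trisection.BoundsDisc T (Trisection.spineHandlebody T j) nj →
      Trisection.BoundsDisc T (Trisection.spineHandlebody T l) nl →
      -- the pants `P`: centre and ends cut `F` into a pair of pants and a thrice-punctured torus
      Disjoint c ej → Disjoint c el → Disjoint ej el →
      Trisection.IsNonSeparating T c → Trisection.IsNonSeparating T ej →
      Trisection.IsNonSeparating T el →
      IsConnected (Trisection.centralSurfaceSet T \ (c ∪ ej)) →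
      IsConnected (Trisection.centralSurfaceSet T \ (c ∪ el)) →
      IsConnected (Trisection.centralSurfaceSet T \ (ej ∪ el)) →
      ¬ IsPreconnected (Trisection.centralSurfaceSet T \ (c ∪ ej ∪ el)) →
      -- the chain: neighbours disjoint from each other and from the same-colour end, dual to the
      -- centre and to the other end
      Disjoint nj nl → Disjoint nj ej → Disjoint nl el →
      Trisection.MeetsOnceTransv nj c → Trisection.MeetsOnceTransv nl c →
      Trisection.MeetsOnceTransv nj el → Trisection.MeetsOnceTransv nl ej →
      ∃ (X' : Type u) (_ : TopologicalSpace X') (_ : T2Space X') (_ : SecondCountableTopology X')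
        (_ : ChartedSpace (EuclideanSpace ℝ (Fin 4)) X') (_ : IsManifold (𝓡 4) ∞ X')
        (k' : Fin 3 → ℕ) (T' : Fin 3 → Set X')
        (ℓ : Metric.sphere (0 : EuclideanSpace ℝ (Fin 2)) 1 → X'),
        IsGKTrisection X' 2 k' T' ∧ IsCircleSurgery (𝓡 4) (𝓡 4) X' X ℓ

end Literature.Topology.FourManifolds

end
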